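import Mathlib
import Summits.PneNP.PneNP.Theorems.PstarPDT
import Summits.PneNP.PneNP.Theorems.PstarSALevel
import Summits.PneNP.PneNP.Theorems.PstarTyped
import Summits.PneNP.PneNP.Theorems.PstarGapLemma
import Summits.PneNP.PneNP.Theorems.PstarGapAdversary
import Summits.PneNP.PneNP.Theorems.PstarGapOneAll
import Summits.PneNP.PneNP.Theorems.PstarGapOneAllOfGSat
import Summits.PneNP.PneNP.Theorems.PstarGConstraint
import Summits.PneNP.PneNP.Theorems.PstarGapFreeVar
import Summits.PneNP.PneNP.Theorems.PstarGSystemFreeVar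
import Summits.PneNP.PneNP.Theorems.PstarGSat

/-!
# Two constraints: the value-pattern image on `Sol(J)` (first consequence of `GSat` at `#W = 2`)

FRONTIER range-avoidance ladder, rung F-N3, ROUND 24 (cell `pnp-ideate`, gap-lemma programme `PstarGapLemma`, towards item T24.18
at `h = 2`; restricted-model proof complexity — nothing here bears on `P` versus `NP`).

`PstarGSat.gSat` (T24.17′) says: on an expanding typed pure-`P⋆` instance with simple overlaps, for `#J ≤ r` and ONE non-constant
`G`-constraint `gval I C G` (`G` disjoint from `J`), the solutions of `J` realise BOTH values.  Applied to `w₁`, to `w₂` and to the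
merged constraint `w₁ ⊕ w₂` (sets `C₁ ∆ C₂`, `G₁ ∆ G₂`; `PstarGSystemFreeVar.gval_symmDiff`) this gives the basic fact behind the
planner's `h = 2` analysis (memo ROUND-24-PRESEED §13 R10(v): "the core has image exactly `{01, 10, 11}`"):

* `three_patterns`: if no solution of `J` satisfies `w₁` and `w₂` together and the three constraints `w₁`, `w₂`, `w₁ ⊕ w₂` are
  non-constant, then solutions of `J` realise each of the three value patterns other than `(b₁, b₂)`.
* `three_patterns_of_minInfeasible`: for a NONEMPTY minimal infeasible `J` under two distinct parity constraints
  `W = {(C₁,b₁), (C₂,b₂)}` the non-constancies are automatic (`left_ne_empty`: `C₁ ≠ ∅`, by `GapOneAll`; `fst_ne`: `C₁ ≠ C₂`), so the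
  image of `(⊕_{C₁} z, ⊕_{C₂} z)` over `Sol(J)` is exactly the three non-target patterns.

Declared here: `sat_pair_iff`, `minInfeasible_pair_comm`, `left_ne_empty`, `fst_ne`, `three_patterns`, `three_patterns_of_minInfeasible`.
-/

set_option linter.dupNamespace false -- `Summit.PneNP.PneNP.…`: summit = sub-problem name (D-0017 single-conjunct layout)

open Finset Literature.Computability.Complexity
open scoped symmDiff
open Summit.PneNP.PneNP.Theorems.PstarPDT (parity)
open Summit.PneNP.PneNP.Theorems.PstarTyped (Typed)
open Summit.PneNP.PneNP.Theorems.PstarSALevel (BoundaryExpanding SimpleOverlap)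
open Summit.PneNP.PneNP.Theorems.PstarGapLemma (Sat Feasible MinInfeasible)
open Summit.PneNP.PneNP.Theorems.PstarGapOneAll (gval gval_empty)
open Summit.PneNP.PneNP.Theorems.PstarGapOneAllOfGSat (parity_empty)
open Summit.PneNP.PneNP.Theorems.PstarGConstraint (gval_nonconst_iff)
open Summit.PneNP.PneNP.Theorems.PstarGSystemFreeVar (gval_symmDiff)
open Summit.PneNP.PneNP.Theorems.PstarGSat (gSat gapOneAll)

namespace Summit.PneNP.PneNP.Theorems.PstarGSatPairs

variable {n m : ℕ}

/-! ## Two `G`-constraints -/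

/-- **Three patterns.**  If no solution of `J` satisfies the two `G`-constraints `w₁ = (C₁,G₁,b₁)`, `w₂ = (C₂,G₂,b₂)` together and
`w₁`, `w₂`, `w₁ ⊕ w₂` are non-constant, then the solutions of `J` realise the three value patterns `(b₁,¬b₂)`, `(¬b₁,b₂)`, `(¬b₁,¬b₂)`. -/
theorem three_patterns (I : LocalMap 4 n m) (hI : I.IsPure xorAndPred) (hT : Typed I) {r : ℕ} (hB : BoundaryExpanding r I)
    (hS : SimpleOverlap I) (y : Fin m → Bool) (J G₁ G₂ : Finset (Fin m)) (C₁ C₂ : Finset (Fin n)) (b₁ b₂ : Bool)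
    (hJr : J.card ≤ r) (hJG₁ : Disjoint J G₁) (hJG₂ : Disjoint J G₂)
    (hunsat : ∀ z : Fin n → Bool, (∀ j ∈ J, I.eval z j = y j) → ¬ (gval I C₁ G₁ z = b₁ ∧ gval I C₂ G₂ z = b₂))
    (hnc₁ : ∃ z z' : Fin n → Bool, gval I C₁ G₁ z ≠ gval I C₁ G₁ z')
    (hnc₂ : ∃ z z' : Fin n → Bool, gval I C₂ G₂ z ≠ gval I C₂ G₂ z')
    (hnc₁₂ : ∃ z z' : Fin n → Bool, gval I (C₁ ∆ C₂) (G₁ ∆ G₂) z ≠ gval I (C₁ ∆ C₂) (G₁ ∆ G₂) z') :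
    (∃ z : Fin n → Bool, (∀ j ∈ J, I.eval z j = y j) ∧ gval I C₁ G₁ z = b₁ ∧ gval I C₂ G₂ z = !b₂) ∧
    (∃ z : Fin n → Bool, (∀ j ∈ J, I.eval z j = y j) ∧ gval I C₁ G₁ z = !b₁ ∧ gval I C₂ G₂ z = b₂) ∧
    (∃ z : Fin n → Bool, (∀ j ∈ J, I.eval z j = y j) ∧ gval I C₁ G₁ z = !b₁ ∧ gval I C₂ G₂ z = !b₂) := by
  refine ⟨?_, ?_, ?_⟩
  · obtain ⟨z, hz, h₁⟩ := gSat n m r I hI hT hB hS y J G₁ C₁ b₁ hJr hJG₁ hnc₁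
    refine ⟨z, hz, h₁, ?_⟩
    have h := hunsat z hz
    revert h h₁; cases gval I C₁ G₁ z <;> cases gval I C₂ G₂ z <;> cases b₁ <;> cases b₂ <;> simp
  · obtain ⟨z, hz, h₂⟩ := gSat n m r I hI hT hB hS y J G₂ C₂ b₂ hJr hJG₂ hnc₂
    refine ⟨z, hz, ?_, h₂⟩
    have h := hunsat z hz
    revert h h₂; cases gval I C₁ G₁ z <;> cases gval I C₂ G₂ z <;> cases b₁ <;> cases b₂ <;> simp
  · have hJG : Disjoint J (G₁ ∆ G₂) := by
      rw [Finset.disjoint_left]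
      intro j hj hj'
      rcases (mem_symmDiff.1 hj') with ⟨h, -⟩ | ⟨h, -⟩
      · exact Finset.disjoint_left.1 hJG₁ hj h
      · exact Finset.disjoint_left.1 hJG₂ hj h
    obtain ⟨z, hz, h⟩ := gSat n m r I hI hT hB hS y J (G₁ ∆ G₂) (C₁ ∆ C₂) (xor b₁ b₂) hJr hJG hnc₁₂
    refine ⟨z, hz, ?_⟩
    rw [gval_symmDiff] at h
    have hu := hunsat z hz
    revert h hu; cases gval I C₁ G₁ z <;> cases gval I C₂ G₂ z <;> cases b₁ <;> cases b₂ <;> simp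

/-! ## Two parity constraints: `W = {(C₁,b₁), (C₂,b₂)}` -/

/-- Satisfying a two-constraint system. -/
theorem sat_pair_iff (C₁ C₂ : Finset (Fin n)) (b₁ b₂ : Bool) (z : Fin n → Bool) :
    Sat ({(C₁, b₁), (C₂, b₂)} : Finset (Finset (Fin n) × Bool)) z ↔ parity C₁ z = b₁ ∧ parity C₂ z = b₂ := by
  constructor
  · intro h
    exact ⟨h _ (mem_insert_self _ _), h _ (mem_insert_of_mem (mem_singleton_self _))⟩
  · rintro ⟨h₁, h₂⟩ e he
    rcases mem_insert.1 he with rfl | he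
    · exact h₁
    · rw [mem_singleton.1 he]; exact h₂

section Pair

variable (I : LocalMap 4 n m) (hI : I.IsPure xorAndPred) (hT : Typed I) {r : ℕ} (hB : BoundaryExpanding r I) (hS : SimpleOverlap I)
  {y : Fin m → Bool} {C₁ C₂ : Finset (Fin n)} {b₁ b₂ : Bool} {J : Finset (Fin m)} (hJr : J.card ≤ r) (hJ : J.Nonempty)
  (hmin : MinInfeasible I y {(C₁, b₁), (C₂, b₂)} J)

include hJ hmin in
/-- A nonempty minimal infeasible set leaves the constraint system itself satisfiable. -/
theorem exists_sat : ∃ z : Fin n → Bool, Sat ({(C₁, b₁), (C₂, b₂)} : Finset (Finset (Fin n) × Bool)) z := by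
  obtain ⟨j, hj⟩ := hJ
  obtain ⟨z, hz, -⟩ := hmin.2 j hj
  exact ⟨z, hz⟩

include hI hT hB hS hJr hJ hmin in
/-- **`C₁ ≠ ∅`**: a trivial first constraint would be contradictory (then `J = ∅`) or idle (then `J = ∅` by `GapOneAll`). -/
theorem left_ne_empty : C₁ ≠ ∅ := by
  intro hC
  obtain ⟨z₀, hz₀⟩ := exists_sat I hJ hmin
  have h₀ := ((sat_pair_iff C₁ C₂ b₁ b₂ z₀).1 hz₀).1
  rw [hC, parity_empty] at h₀
  have hmin' : MinInfeasible I y {(C₂, b₂)} J := by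
    refine ⟨?_, fun j hj => ?_⟩
    · rintro ⟨z, hz, hzJ⟩
      refine hmin.1 ⟨z, (sat_pair_iff C₁ C₂ b₁ b₂ z).2 ⟨?_, hz _ (mem_singleton_self _)⟩, hzJ⟩
      rw [hC, parity_empty, h₀]
    · obtain ⟨z, hz, hzJ⟩ := hmin.2 j hj
      exact ⟨z, fun e he => hz e (mem_insert_of_mem he), hzJ⟩
  exact hJ.ne_empty (gapOneAll n m r I hI hT hB hS y {(C₂, b₂)} J (by rw [card_singleton]) hJr hmin')

include hJ hmin in
/-- **`C₁ ≠ C₂`** for two distinct constraints: equal sets with different bits are contradictory (then `J = ∅`). -/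
theorem fst_ne (hne : (C₁, b₁) ≠ (C₂, b₂)) : C₁ ≠ C₂ := by
  intro hC
  obtain ⟨z₀, hz₀⟩ := exists_sat I hJ hmin
  have h := (sat_pair_iff C₁ C₂ b₁ b₂ z₀).1 hz₀
  rw [hC] at h
  exact hne (by rw [hC, h.1.symm.trans h.2])

include hI hT hB hS hJr hJ hmin in
/-- **The `h = 2` image.**  For a nonempty minimal infeasible `J` (`#J ≤ r`) under two distinct parity constraints on an expanding
typed pure-`P⋆` instance with simple overlaps, the solutions of `J` realise exactly the three value patterns of
`(⊕_{C₁} z, ⊕_{C₂} z)` other than `(b₁, b₂)`. -/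
theorem three_patterns_of_minInfeasible (hne : (C₁, b₁) ≠ (C₂, b₂)) :
    (∃ z : Fin n → Bool, (∀ j ∈ J, I.eval z j = y j) ∧ parity C₁ z = b₁ ∧ parity C₂ z = !b₂) ∧
    (∃ z : Fin n → Bool, (∀ j ∈ J, I.eval z j = y j) ∧ parity C₁ z = !b₁ ∧ parity C₂ z = b₂) ∧
    (∃ z : Fin n → Bool, (∀ j ∈ J, I.eval z j = y j) ∧ parity C₁ z = !b₁ ∧ parity C₂ z = !b₂) := by
  have hC₁ : C₁ ≠ ∅ := left_ne_empty I hI hT hB hS hJr hJ hmin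
  have hmin₂ : MinInfeasible I y {(C₂, b₂), (C₁, b₁)} J := by rwa [Finset.pair_comm]
  have hC₂ : C₂ ≠ ∅ := left_ne_empty I hI hT hB hS hJr hJ hmin₂
  have h12 : C₁ ≠ C₂ := fst_ne I hJ hmin hne
  have nc : ∀ C : Finset (Fin n), C ≠ ∅ → ∃ z z' : Fin n → Bool, gval I C ∅ z ≠ gval I C ∅ z' := fun C hC =>
    (gval_nonconst_iff I (G := ∅) (fun g hg => absurd hg (by simp)) (fun g hg => absurd hg (by simp))).2 (Or.inl hC)
  have hunsat : ∀ z : Fin n → Bool, (∀ j ∈ J, I.eval z j = y j) → ¬ (gval I C₁ ∅ z = b₁ ∧ gval I C₂ ∅ z = b₂) := by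
    intro z hz h
    rw [gval_empty, gval_empty] at h
    exact hmin.1 ⟨z, (sat_pair_iff C₁ C₂ b₁ b₂ z).2 h, hz⟩
  have hnc₁₂ : ∃ z z' : Fin n → Bool, gval I (C₁ ∆ C₂) (∅ ∆ ∅) z ≠ gval I (C₁ ∆ C₂) (∅ ∆ ∅) z' := by
    rw [symmDiff_self, Finset.bot_eq_empty]
    exact nc _ fun h => h12 (Finset.symmDiff_eq_empty.1 h)
  have h := three_patterns I hI hT hB hS y J ∅ ∅ C₁ C₂ b₁ b₂ hJr (disjoint_empty_right _) (disjoint_empty_right _) hunsat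
    (nc C₁ hC₁) (nc C₂ hC₂) hnc₁₂
  simpa only [gval_empty] using h

end Pair

end Summit.PneNP.PneNP.Theorems.PstarGSatPairs
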